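import Summits.QuantumFields.BalabanUV.T4Continuum.Support.VariationalTaxiTowerEnd
import Summits.QuantumFields.BalabanUV.T4Continuum.Support.VariationalTaxiTowerFluxTower
import Summits.QuantumFields.BalabanUV.T4Continuum.Support.VariationalCovariantEndLocal

/-!
# T⁴ programme, spine node NE2 (U1a), lane P2 — SUPPORT: THE COHERENT TAXI TOWER (U(1)), PART 2b — THE FRAME-FREE TAXI TOWER END and its
# NON-FLAT INSTANCE: the road owner's `towerLimitRate_scalarTower_closed_local` for the nested taxi tower from FOUR data hypotheses and
# NOTHING ELSE, and the constant-flux tower as an explicit inhabitant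

NE2 formalisation swarm `b2b-balaban-t4-ne2-formalise-*`, leaf 04 GEN 3 (`prover-b2b-balaban-t4-ne2-formalise-leaf-04-g3-0`); register
P2-sup item (O7) «TAXI TOWER END» (road owner `t4-ne2-p2` gen 11, GO CLAIMS.log l.11188; INTENT l.11043).  PART 2 (`VariationalTaxiTowerEnd`,
p215570) inhabited `…EndRel` (p215080) with the P⁺ frames still displayed.  The owner's `VariationalCovariantEndLocal.
towerLimitRate_scalarTower_closed_local` (frame-free: leaf P⁺ per unit block from the reference transport's in-block defect and the relative
phase, leaf-01-g4's `VariationalCovariantPoincareLocal` ∕ `…ScalarPairLocal`) has NO frame binder; THIS FILE instantiates it.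

THE THEOREMS ([folklore], OURS; U(1), abelian contours, model level).
 * §1 the three LOCAL smallness lines of the frame-free END at taxi data from polynomial smallness of the class constant `c`:
   `habsorb_local_taxiTower` (`64d((d−1)c)² ≤ ½ ⇒ 64d(n·m_k)² ≤ ½`), `hsmall_local_taxiTower` (`2d((d−1)c)² + 4γ² ≤ ½ ⇒ 2d(n·w_k)² + 4γ² ≤ ½`),
   `hsmall₁_taxiTower` (`2d(L(d−1)c)² ≤ ½ ⇒ 2d(L·m₁,k)² ≤ ½`);
 * §2 **`towerLimitRate_taxiTower`** — THE FRAME-FREE TAXI TOWER END: for a COHERENT tower of unit one-step phases `R′ k` with plaquette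
   defects `a′_k`, ONE class line `(L^k·L)²·a′_k ≤ c`, coherence `coarseT L (fine (L^(k+1)) M) (R′ (k+1)) = Rtr (L^k) L M (R′ k)`, and FOUR
   polynomial smallness lines on `c` (`64d((d−1)c)² ≤ ½`, `2d((d−1)c)² + 4(4d²c)² ≤ ½`, `2d(L(d−1)c)² ≤ ½`, `4d²c < 1`), `1 ≤ d`, `2 ≤ L`,
   `0 < a₀`:  `TowerLimitRate (fun _ ↦ 1) 1 (fun k => effSc (L^k) M (coarseT L (fine (L^k) M) (R′ k)) (nestT L M R′ k) a₀)
   (cEnd d L ((4 + (d−1)c)/(1 − 4d²c)) c ((d−1)c) ((d−1)c)) L⁻¹` — NO frame, NO global gauge, NO transport datum besides the phases;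
 * §3 **`towerLimitRate_fluxTower`** — THE NON-FLAT INSTANCE: the constant-flux tower (`q` flux quanta through the `(μ₀, μ₁)`-plane of the torus,
   PART 3 `VariationalTaxiTowerFlux(Tower)`) satisfies (i)–(iii) with `c = 2πq/(M μ₀ · M μ₁)` EXACTLY, so for a torus with
   enough unit blocks in that plane (the four smallness lines at this `c`, displayed as hypotheses on `M`, `q`, `d`, `L`) the η-rate holds for
   its effective scalar covariant forms — and its plaquettes are NOT `1` (`plaq_fluxTower_ne_one`).

HONEST FRAMING (T4-DAG p. 1).  Instantiation at MODEL level (U(1) charged scalar; abelian taxi ∕ straight contours; OUR typed objects;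
[Balaban1985BackgroundPropagators] (3.15)∕(3.19) p.393 SHAPES only); honest limit as the owner's: small field PER UNIT BLOCK, k-uniform; [folklore];
nothing printed is a hypothesis; no `def`; no `def … : Prop`; no `sorry`; axioms standard.  NOT tier B, NOT NE2⁺ as printed, nothing about Bałaban's
`U_k(V)` (no B0) or node NE3; NE2 NOT proved on either road; spine 0/9; rung (B)+1 finite T⁴ — NOT infinite volume, NOT mass gap, NOT Clay.
HONEST DEPENDENCY (cell, verbatim): continuum YM on T⁴ ⇐ BetaPertH ∧ nine spine estimates (0/9 proved); BetaPertH ⇐ (D1) ∧ (D4) ∧ CAP+tail;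
G-an2-4 gates asym, D1 and NE2/3/4.
-/

noncomputable section

open scoped Matrix ComplexConjugate ComplexOrder Matrix.Norms.L2Operator BigOperators

namespace Summit.QuantumFields.BalabanUV.T4Continuum.VariationalTaxiTowerEndLocal

open Literature.MathematicalPhysics.QuantumFieldTheory.Balaban1983to89.B5Prop11Plancherel (Tor fine unitVec)
open Literature.MathematicalPhysics.QuantumFieldTheory.Balaban1983to89.B5Block118 (bpt)
open Summit.QuantumFields.BalabanUV.T4Continuum.VariationalCovariantEffective (effSc)
open Summit.QuantumFields.BalabanUV.T4Continuum.VariationalCovariantTower (compT Rtr)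
open Summit.QuantumFields.BalabanUV.T4Continuum.VariationalCovariantEnd (cEnd)
open Summit.QuantumFields.BalabanUV.T4Continuum.VariationalCovariantEndLocal (towerLimitRate_scalarTower_closed_local)
open Summit.QuantumFields.BalabanUV.T4Continuum.CovariantAveragingTower (TowerLimitRate)
open Summit.QuantumFields.BalabanUV.T4Continuum.VariationalTaxiTransport
open Summit.QuantumFields.BalabanUV.T4Continuum.VariationalTaxiCoarse
open Summit.QuantumFields.BalabanUV.T4Continuum.VariationalTaxiTower
open Summit.QuantumFields.BalabanUV.T4Continuum.VariationalTaxiTowerEnd (hrel_taxiTower)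
open Summit.QuantumFields.BalabanUV.T4Continuum.VariationalTaxiTowerFluxTower

variable {d : ℕ} (L : ℕ) [NeZero L] (M : Fin d → ℕ) [hM : ∀ μ, NeZero (M μ)]

/-! ## §1 The local smallness lines at taxi data -/

section Small

variable {a' : ℕ → ℝ} (ha0 : ∀ k, 0 ≤ a' k) {c : ℝ} (hclass : ∀ k, ((((L ^ k : ℕ)) : ℝ) * L) ^ 2 * a' k ≤ c)
include ha0 hclass

omit hM in
/-- `n·m_k ≤ (d−1)c` (via `n·m_k ≤ n²·m_k`) for the taxi mismatch `m_k = (d−1)L(L−1)a′_k`. [folklore] -/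
theorem n_mul_m_le (k : ℕ) :
    (((L ^ k : ℕ)) : ℝ) * (((d - 1 : ℕ) : ℝ) * ((L : ℝ) * ((L - 1 : ℕ) : ℝ) * a' k)) ≤ ((d - 1 : ℕ) : ℝ) * c := by
  have hn1 : (1 : ℝ) ≤ (((L ^ k : ℕ)) : ℝ) := by exact_mod_cast Nat.one_le_iff_ne_zero.mpr (NeZero.ne (L ^ k))
  have hm0 : 0 ≤ ((d - 1 : ℕ) : ℝ) * ((L : ℝ) * ((L - 1 : ℕ) : ℝ) * a' k) := by have := ha0 k; positivity
  refine le_trans ?_ (class_taxiTower (d := d) L ha0 hclass k).2.2.1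
  have : (((L ^ k : ℕ)) : ℝ) ≤ (((L ^ k : ℕ)) : ℝ) ^ 2 := by nlinarith
  exact mul_le_mul_of_nonneg_right this hm0

omit hM in
/-- `m₁,k ≤ (d−1)c` for the one-step taxi defect `m₁,k = (d−1)(L−1)(L+1)a′_k`. [folklore] -/
theorem m₁_le (k : ℕ) : ((d - 1 : ℕ) : ℝ) * ((L - 1 : ℕ) : ℝ) * ((L : ℝ) + 1) * a' k ≤ ((d - 1 : ℕ) : ℝ) * c := by
  have hn1 : (1 : ℝ) ≤ (((L ^ k : ℕ)) : ℝ) := by exact_mod_cast Nat.one_le_iff_ne_zero.mpr (NeZero.ne (L ^ k))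
  have hm0 : 0 ≤ ((d - 1 : ℕ) : ℝ) * ((L - 1 : ℕ) : ℝ) * ((L : ℝ) + 1) * a' k := by have := ha0 k; positivity
  refine le_trans ?_ (class_taxiTower (d := d) L ha0 hclass k).2.2.2
  have : (1 : ℝ) ≤ (((L ^ k : ℕ)) : ℝ) ^ 2 := by nlinarith
  nlinarith

omit hM in
/-- the frame-free END's FED⁺ absorption at taxi data: `64d((d−1)c)² ≤ ½ ⇒ 64d(n·m_k)² ≤ ½`. [folklore] -/
theorem habsorb_local_taxiTower (hc : 64 * (d : ℝ) * (((d - 1 : ℕ) : ℝ) * c) ^ 2 ≤ 1 / 2) (k : ℕ) :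
    64 * (d : ℝ) * ((((L ^ k : ℕ)) : ℝ) * (((d - 1 : ℕ) : ℝ) * ((L : ℝ) * ((L - 1 : ℕ) : ℝ) * a' k))) ^ 2 ≤ 1 / 2 := by
  have h := n_mul_m_le (d := d) L ha0 hclass k
  have h0 : 0 ≤ (((L ^ k : ℕ)) : ℝ) * (((d - 1 : ℕ) : ℝ) * ((L : ℝ) * ((L - 1 : ℕ) : ℝ) * a' k)) := by have := ha0 k; positivity
  have hsq := pow_le_pow_left₀ h0 h 2
  nlinarith [Nat.cast_nonneg (α := ℝ) d]

omit hM in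
/-- the frame-free END's per-block P⁺ smallness at taxi data: `2d((d−1)c)² + 4γ² ≤ ½ ⇒ 2d(n·w_k)² + 4γ² ≤ ½`. [folklore] -/
theorem hsmall_local_taxiTower {γ : ℝ} (hc : 2 * (d : ℝ) * (((d - 1 : ℕ) : ℝ) * c) ^ 2 + 4 * γ ^ 2 ≤ 1 / 2) (k : ℕ) :
    2 * (d : ℝ) * ((((L ^ k : ℕ)) : ℝ) * (((d - 1 : ℕ) : ℝ) * ((L ^ k - 1 : ℕ) : ℝ) * ((L : ℝ) * L * a' k))) ^ 2 + 4 * γ ^ 2 ≤ 1 / 2 := by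
  have h := (class_taxiTower (d := d) L ha0 hclass k).1
  have h0 : 0 ≤ (((L ^ k : ℕ)) : ℝ) * (((d - 1 : ℕ) : ℝ) * ((L ^ k - 1 : ℕ) : ℝ) * ((L : ℝ) * L * a' k)) := by have := ha0 k; positivity
  have hsq := pow_le_pow_left₀ h0 h 2
  nlinarith [Nat.cast_nonneg (α := ℝ) d]

omit hM in
/-- the frame-free END's one-step smallness at taxi data: `2d(L(d−1)c)² ≤ ½ ⇒ 2d(L·m₁,k)² ≤ ½`. [folklore] -/
theorem hsmall₁_taxiTower (hc : 2 * (d : ℝ) * ((L : ℝ) * (((d - 1 : ℕ) : ℝ) * c)) ^ 2 ≤ 1 / 2) (k : ℕ) :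
    2 * (d : ℝ) * ((L : ℝ) * (((d - 1 : ℕ) : ℝ) * ((L - 1 : ℕ) : ℝ) * ((L : ℝ) + 1) * a' k)) ^ 2 ≤ 1 / 2 := by
  have h := m₁_le (d := d) L ha0 hclass k
  have h0 : 0 ≤ (L : ℝ) * (((d - 1 : ℕ) : ℝ) * ((L - 1 : ℕ) : ℝ) * ((L : ℝ) + 1) * a' k) := by have := ha0 k; positivity
  have h1 : (L : ℝ) * (((d - 1 : ℕ) : ℝ) * ((L - 1 : ℕ) : ℝ) * ((L : ℝ) + 1) * a' k) ≤ (L : ℝ) * (((d - 1 : ℕ) : ℝ) * c) :=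
    mul_le_mul_of_nonneg_left h (Nat.cast_nonneg _)
  have hsq := pow_le_pow_left₀ h0 h1 2
  nlinarith [Nat.cast_nonneg (α := ℝ) d]

end Small

/-! ## §2 The frame-free taxi tower END -/

section End

/-- **THE FRAME-FREE TAXI TOWER END.**  The road owner's `towerLimitRate_scalarTower_closed_local` INHABITED by the coherent taxi tower with
NO frame and NO transport datum besides the phases: unit one-step phases `R′ k`, plaquette defects `a′_k` with ONE class line
`(L^k·L)²·a′_k ≤ c`, COHERENCE `coarseT (R′ (k+1)) = Rtr (R′ k)`, four polynomial smallness lines on `c`, `1 ≤ d`, `2 ≤ L`, `0 < a₀` ⟹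
the η-rate `TowerLimitRate (fun _ ↦ 1) 1 (fun k => effSc (L^k) M (coarseT … (R′ k)) (nestT L M R′ k) a₀) (cEnd d L c_w′ c ((d−1)c) ((d−1)c)) L⁻¹`,
`c_w′ = (4 + (d−1)c)/(1 − 4d²c)`.  Model level (small field per unit block); NE2 NOT proved. [folklore] -/
theorem towerLimitRate_taxiTower (hd : 1 ≤ d) (hL : 2 ≤ L)
    {R' : (k : ℕ) → Tor (fine L (fine (L ^ k) M)) → Fin d → ℂ} (hR1 : ∀ k x μ, ‖R' k x μ‖ = 1)
    {a' : ℕ → ℝ} (ha0 : ∀ k, 0 ≤ a' k) (ha' : ∀ k x κ ι, ‖plaq L (fine (L ^ k) M) (R' k) x κ ι - 1‖ ≤ a' k)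
    (hcoh : ∀ k, coarseT L (fine (L ^ (k + 1)) M) (R' (k + 1)) = Rtr (L ^ k) L M (R' k))
    {c : ℝ} (hclass : ∀ k, ((((L ^ k : ℕ)) : ℝ) * L) ^ 2 * a' k ≤ c)
    (hc₁ : 64 * (d : ℝ) * (((d - 1 : ℕ) : ℝ) * c) ^ 2 ≤ 1 / 2)
    (hc₂ : 2 * (d : ℝ) * (((d - 1 : ℕ) : ℝ) * c) ^ 2 + 4 * (4 * (d : ℝ) ^ 2 * c) ^ 2 ≤ 1 / 2)
    (hc₃ : 2 * (d : ℝ) * ((L : ℝ) * (((d - 1 : ℕ) : ℝ) * c)) ^ 2 ≤ 1 / 2) (hc₄ : 4 * (d : ℝ) ^ 2 * c < 1)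
    {a₀ : ℝ} (ha₀ : 0 < a₀) :
    TowerLimitRate (ι := fun _ => Tor M) (fun _ => (1 : Matrix (Tor M) (Tor M) ℂ)) 1
      (fun k => effSc (L ^ k) M (coarseT L (fine (L ^ k) M) (R' k)) (nestT L M R' k) a₀)
      (cEnd d L ((4 + ((d - 1 : ℕ) : ℝ) * c) / (1 - 4 * (d : ℝ) ^ 2 * c)) c (((d - 1 : ℕ) : ℝ) * c) (((d - 1 : ℕ) : ℝ) * c))
      ((L : ℝ)⁻¹) :=
  towerLimitRate_scalarTower_closed_local L M
    (Rc := fun k => coarseT L (fine (L ^ k) M) (R' k)) (T := nestT L M R')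
    (T₀ := fun k => taxiT (L ^ k) M (coarseT L (fine (L ^ k) M) (R' k)))
    (R' := R') (T' := fun k => taxiT L (fine (L ^ k) M) (R' k))
    (m := fun k => ((d - 1 : ℕ) : ℝ) * ((L : ℝ) * ((L - 1 : ℕ) : ℝ) * a' k))
    (w := fun k => ((d - 1 : ℕ) : ℝ) * ((L ^ k - 1 : ℕ) : ℝ) * ((L : ℝ) * L * a' k))
    (w' := fun k => (4 + ((d - 1 : ℕ) : ℝ) * c) / (1 - 4 * (d : ℝ) ^ 2 * c) / (((L ^ k : ℕ)) : ℝ))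
    (a := fun k => (L : ℝ) * L * a' k)
    (m₁ := fun k => ((d - 1 : ℕ) : ℝ) * ((L - 1 : ℕ) : ℝ) * ((L : ℝ) + 1) * a' k)
    hd hL (norm_nestT L M hR1) (norm_coarseT_tower L M hR1) (norm_R'_le L M hR1) (norm_taxiT_step L M hR1)
    (fun _ => rfl) (fun k => hcoh k)
    (fun k => by have := ha0 k; positivity) (hmis_taxiTower L M hR1 ha') (habsorb_local_taxiTower L ha0 hclass hc₁)
    (norm_taxiT_ref L M hR1) (fun k => by have := ha0 k; positivity) (hwin_taxiTower L M hR1 ha') hc₄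
    (hrel_taxiTower L M hL hR1 ha0 ha' hclass hcoh) (hsmall_local_taxiTower L ha0 hclass hc₂)
    (fun k => (hw'_taxiTower (d := d) L ha0 hclass hc₄ k).2.2) (fun k => (hw'_taxiTower (d := d) L ha0 hclass hc₄ k).1)
    (fun k => by have := ha0 k; positivity) (hP_taxiTower L M hR1 ha')
    (fun k => by have := ha0 k; positivity) (hin_taxiTower L M hR1 ha') (hcross_taxiTower L M hR1 ha')
    (hsmall₁_taxiTower L ha0 hclass hc₃)
    (fun k => (hw'_taxiTower (d := d) L ha0 hclass hc₄ k).2.1) (fun k => (class_taxiTower (d := d) L ha0 hclass k).2.1)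
    (fun k => (class_taxiTower (d := d) L ha0 hclass k).2.2.1) (fun k => (class_taxiTower (d := d) L ha0 hclass k).2.2.2) ha₀

end End

/-! ## §3 The non-flat instance: the constant-flux tower -/

section Flux

/-- **THE η-RATE FOR THE CONSTANT-FLUX TOWER** (`q` flux quanta through the `(μ₀, μ₁)`-plane; a NON-FLAT member of the data class): the
frame-free taxi tower END at `R′ := fluxTower L M μ₀ μ₁ q`, with (i) unit, (ii) plaquette class at `c = 2πq/(M μ₀ · M μ₁)` EXACTLY,
(iii) coherence DISCHARGED by PART 3; the four smallness lines at this `c` stay displayed (they hold for tori with enough unit blocks in the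
plane).  Model level; NE2 NOT proved. [folklore] -/
theorem towerLimitRate_fluxTower (hd : 1 ≤ d) (hL : 2 ≤ L) {μ₀ μ₁ : Fin d} (hne : μ₀ ≠ μ₁) (q : ℕ)
    (hc₁ : 64 * (d : ℝ) * (((d - 1 : ℕ) : ℝ) * (2 * Real.pi * q / ((M μ₀ : ℝ) * M μ₁))) ^ 2 ≤ 1 / 2)
    (hc₂ : 2 * (d : ℝ) * (((d - 1 : ℕ) : ℝ) * (2 * Real.pi * q / ((M μ₀ : ℝ) * M μ₁))) ^ 2
        + 4 * (4 * (d : ℝ) ^ 2 * (2 * Real.pi * q / ((M μ₀ : ℝ) * M μ₁))) ^ 2 ≤ 1 / 2)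
    (hc₃ : 2 * (d : ℝ) * ((L : ℝ) * (((d - 1 : ℕ) : ℝ) * (2 * Real.pi * q / ((M μ₀ : ℝ) * M μ₁)))) ^ 2 ≤ 1 / 2)
    (hc₄ : 4 * (d : ℝ) ^ 2 * (2 * Real.pi * q / ((M μ₀ : ℝ) * M μ₁)) < 1)
    {a₀ : ℝ} (ha₀ : 0 < a₀) :
    TowerLimitRate (ι := fun _ => Tor M) (fun _ => (1 : Matrix (Tor M) (Tor M) ℂ)) 1
      (fun k => effSc (L ^ k) M (coarseT L (fine (L ^ k) M) (fluxTower L M μ₀ μ₁ q k)) (nestT L M (fluxTower L M μ₀ μ₁ q) k) a₀)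
      (cEnd d L ((4 + ((d - 1 : ℕ) : ℝ) * (2 * Real.pi * q / ((M μ₀ : ℝ) * M μ₁))) / (1 - 4 * (d : ℝ) ^ 2 * (2 * Real.pi * q / ((M μ₀ : ℝ) * M μ₁))))
        (2 * Real.pi * q / ((M μ₀ : ℝ) * M μ₁)) (((d - 1 : ℕ) : ℝ) * (2 * Real.pi * q / ((M μ₀ : ℝ) * M μ₁)))
        (((d - 1 : ℕ) : ℝ) * (2 * Real.pi * q / ((M μ₀ : ℝ) * M μ₁))))
      ((L : ℝ)⁻¹) :=
  towerLimitRate_taxiTower L M hd hL (norm_fluxTower L M μ₀ μ₁ q)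
    (a' := fun k => 2 * Real.pi * q / ((((L ^ (k + 1) * M μ₀ : ℕ)) : ℝ) * (((L ^ (k + 1) * M μ₁ : ℕ)) : ℝ)))
    (fun k => by positivity) (plaq_fluxTower_sub_one_le L M μ₀ μ₁ q hL hne) (fluxTower_coherent L M μ₀ μ₁ q hne)
    (fun k => (class_fluxTower L M μ₀ μ₁ q (NeZero.ne L) k).le) hc₁ hc₂ hc₃ hc₄ ha₀

end Flux

end Summit.QuantumFields.BalabanUV.T4Continuum.VariationalTaxiTowerEndLocal

end
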